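import Literature.RepresentationTheory.FiniteGroups.GLnCharacterDegreeBound
import Literature.RepresentationTheory.FiniteGroups.BrauerTheorem
import Literature.NumberTheory.DiophantineGeometry.PartitionTableaux
import HarnessLib

/-!
# Green's degree bound for `GL_n(𝔽_p)`: the elementary half of the printed derivation

Topic `Literature/RepresentationTheory/FiniteGroups`.  Companion to `GLnCharacterDegreeBound` (the named fact
`GreenGLnDegreeBound : ∀ n p χ, χ(1) ≤ 2^n p^{n(n-1)/2}` for `χ ∈ Irr(GL_n(𝔽_p))`).

The derivation recorded in that file's docstring has two halves:

1. **Green's degree formula** (Green 1955; Macdonald, *Symmetric Functions and Hall Polynomials*, 2nd ed.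
   1995, Ch. IV §6 (6.7)–(6.8)): every irreducible character of `GL_n(𝔽_q)` is a `χ^λ`, `λ : Θ → 𝒫` a
   partition-valued function on the Frobenius orbits with `‖λ‖ = Σ_φ d(φ)|λ(φ)| = n`, of degree
   `d_λ = ψ_n(q) ∏_φ q_φ^{n(λ(φ)')} H̃_{λ(φ)}(q_φ)^{-1}`, `q_φ = q^{d(φ)}`, `ψ_n(q) = ∏_{i=1}^n (q^i - 1)`,
   `H̃_μ(t) = ∏_{x ∈ μ} (t^{h(x)} - 1)`.  This is Green's theory (Hall algebra, Hall–Littlewood functions, the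
   characteristic map; Macdonald Ch. II–IV) and is NOT in the tree.
2. **The hook estimate** (loc. cit., "immediate"): `t^h - 1 ≥ t^h / 2` (`t ≥ 2`, `h ≥ 1`) and
   `Σ_{x ∈ μ} h(x) ≥ |μ| + n(μ')` give `q_φ^{n(μ')} H̃_μ(q_φ)^{-1} ≤ 2^{|μ|} q_φ^{-|μ|}`, hence
   `d_λ ≤ 2^{Σ|λ(φ)|} q^{-‖λ‖} ψ_n(q) ≤ 2^n q^{-n} ψ_n(q) ≤ 2^n q^{n(n-1)/2}`.

This file PROVES half 2 in the exact shape half 1 delivers it (`degree_le_of_hook_identity`,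
`re_apply_one_le_of_hook_identity`: a degree `deg` satisfying the division-free identity
`deg · ∏_i H̃_{μ_i}(q^{d_i}) = ψ_n(q) · ∏_i (q^{d_i})^{n(μ_i')}` for a finite family of degrees `d_i ≥ 1` and
diagrams `μ_i` with `Σ_i d_i |μ_i| = n` is at most `2^n q^{n(n-1)/2}`), together with the cases `n ≤ 1` of the
bound itself (`GL_0`, `GL_1` are abelian, all degrees are `1`).  Partitions are Mathlib's `YoungDiagram`
(cells `(i, j)` `0`-indexed, so `n(μ') = Σ_{(i,j) ∈ μ} j` since `n(μ) = Σ_i (i-1) μ_i`, Macdonald I §1), and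
`h(x)` is the tree's `hookLength` (`Literature/NumberTheory/DiophantineGeometry/PartitionTableaux`).

The hook estimate is organised through the **arm involution** `(i, j) ↦ (i, μ_i - 1 - j)` of the diagram:
`h(i, j) ≥ μ_i - j` (the arm and the box itself), and `Σ_{(i,j) ∈ μ} (μ_i - j) = Σ_{(i,j) ∈ μ} (j + 1) =
n(μ') + |μ|`; so `∏_x q_φ^{μ_i - j} = q_φ^{|μ| + n(μ')} ≤ ∏_x 2 (q_φ^{h(x)} - 1) = 2^{|μ|} H̃_μ(q_φ)` — this
replaces the identity `Σ h(x) = |μ| + n(μ) + n(μ')` (Macdonald I §1 Ex. 2) of the printed argument by the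
inequality that is actually used.

## What is NOT here

`theorem GreenGLnDegreeBound_holds`: it needs half 1 (Green's classification of `Irr(GL_n(𝔽_q))` with the
degree formula), a theory absent from Mathlib and the tree.  Given half 1 in the division-free form above,
`GreenGLnDegreeBound` follows from `re_apply_one_le_of_hook_identity` in three lines.

## References

* I. G. Macdonald, *Symmetric Functions and Hall Polynomials*, 2nd ed. (1995), Ch. IV §6 (6.7)–(6.8); Ch. I
  §1 Ex. 1–2 [Macdonald1995].
* J. A. Green, *The characters of the finite general linear groups*, Trans. Amer. Math. Soc. 80 (1955),
  402–447 [Green1955].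
-/

noncomputable section

open scoped BigOperators

namespace Literature.RepresentationTheory.FiniteGroups

open Literature.NumberTheory.DiophantineGeometry (hookLength one_le_hookLength)

namespace GreenGLn

/-! ### The hook estimate for one diagram -/

/-- The hook of the box `(i, j)` contains the `μ_i - j` boxes weakly to its right: `μ_i - j ≤ h(i, j)`
(Macdonald I §1 Ex. 1: `h(i,j) = λ_i + λ'_j - i - j + 1` with `λ'_j ≥ i`). [cite: Macdonald1995, Ch. I §1 Ex. 1] -/
theorem rowLen_sub_snd_le_hookLength {μ : YoungDiagram} {c : ℕ × ℕ} (hc : c ∈ μ.cells) :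
    μ.rowLen c.1 - c.2 ≤ hookLength μ c := by
  obtain ⟨i, j⟩ := c
  have h₁ : i < μ.colLen j := YoungDiagram.mem_iff_lt_colLen.1 ((YoungDiagram.mem_cells _).1 hc)
  simp only [hookLength]
  omega

/-- Per box: `Q^{μ_i - j} ≤ Q^{h(x)} ≤ 2 (Q^{h(x)} - 1)` for `Q ≥ 2` (the estimate `t^h - 1 ≥ t^h/2` of the
printed derivation). [cite: Macdonald1995, Ch. IV §6 (6.7)] -/
theorem pow_rowLen_sub_le {Q : ℕ} (hQ : 2 ≤ Q) {μ : YoungDiagram} {c : ℕ × ℕ} (hc : c ∈ μ.cells) :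
    Q ^ (μ.rowLen c.1 - c.2) ≤ 2 * (Q ^ hookLength μ c - 1) := by
  have h1 : Q ^ (μ.rowLen c.1 - c.2) ≤ Q ^ hookLength μ c :=
    Nat.pow_le_pow_right (by omega) (rowLen_sub_snd_le_hookLength hc)
  have h2 : 2 ≤ Q ^ hookLength μ c :=
    calc 2 ≤ Q ^ 1 := by simpa using hQ
      _ ≤ Q ^ hookLength μ c := Nat.pow_le_pow_right (by omega) (one_le_hookLength hc)
  omega

/-- The arm involution `(i, j) ↦ (i, μ_i - 1 - j)` of a diagram turns `Σ_{(i,j) ∈ μ} (μ_i - j)` into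
`Σ_{(i,j) ∈ μ} (j + 1)`. [folklore] -/
theorem sum_rowLen_sub_eq (μ : YoungDiagram) :
    ∑ c ∈ μ.cells, (μ.rowLen c.1 - c.2) = ∑ c ∈ μ.cells, (c.2 + 1) := by
  refine Finset.sum_nbij' (fun c => (c.1, μ.rowLen c.1 - 1 - c.2)) (fun c => (c.1, μ.rowLen c.1 - 1 - c.2))
    ?_ ?_ ?_ ?_ ?_
  · rintro ⟨i, j⟩ hc
    have hj : j < μ.rowLen i := YoungDiagram.mem_iff_lt_rowLen.1 ((YoungDiagram.mem_cells _).1 hc)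
    show (i, μ.rowLen i - 1 - j) ∈ μ.cells
    exact (YoungDiagram.mem_cells _).2 (YoungDiagram.mem_iff_lt_rowLen.2 (by omega))
  · rintro ⟨i, j⟩ hc
    have hj : j < μ.rowLen i := YoungDiagram.mem_iff_lt_rowLen.1 ((YoungDiagram.mem_cells _).1 hc)
    show (i, μ.rowLen i - 1 - j) ∈ μ.cells
    exact (YoungDiagram.mem_cells _).2 (YoungDiagram.mem_iff_lt_rowLen.2 (by omega))
  · rintro ⟨i, j⟩ hc
    have hj : j < μ.rowLen i := YoungDiagram.mem_iff_lt_rowLen.1 ((YoungDiagram.mem_cells _).1 hc)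
    simp only [Prod.mk.injEq, true_and]
    omega
  · rintro ⟨i, j⟩ hc
    have hj : j < μ.rowLen i := YoungDiagram.mem_iff_lt_rowLen.1 ((YoungDiagram.mem_cells _).1 hc)
    simp only [Prod.mk.injEq, true_and]
    omega
  · rintro ⟨i, j⟩ hc
    have hj : j < μ.rowLen i := YoungDiagram.mem_iff_lt_rowLen.1 ((YoungDiagram.mem_cells _).1 hc)
    simp only
    omega

/-- `Σ_{(i,j) ∈ μ} (j + 1) = n(μ') + |μ|` with `n(μ') = Σ_{(i,j) ∈ μ} j`. [folklore] -/
theorem sum_snd_add_one (μ : YoungDiagram) :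
    ∑ c ∈ μ.cells, (c.2 + 1) = (∑ c ∈ μ.cells, c.2) + μ.cells.card := by
  rw [Finset.sum_add_distrib, Finset.sum_const, smul_eq_mul, mul_one]

/-- **The hook estimate** `Q^{|μ| + n(μ')} ≤ 2^{|μ|} H̃_μ(Q)` for `Q ≥ 2`, i.e.
`Q^{n(μ')} H̃_μ(Q)^{-1} ≤ 2^{|μ|} Q^{-|μ|}` (Macdonald IV §6, the step from (6.7) to the degree bound).
[cite: Macdonald1995, Ch. IV §6 (6.7)] -/
theorem pow_card_add_colWeight_le {Q : ℕ} (hQ : 2 ≤ Q) (μ : YoungDiagram) :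
    Q ^ (μ.cells.card + ∑ c ∈ μ.cells, c.2) ≤
      2 ^ μ.cells.card * ∏ c ∈ μ.cells, (Q ^ hookLength μ c - 1) := by
  have h := Finset.prod_le_prod (s := μ.cells) (f := fun c => Q ^ (μ.rowLen c.1 - c.2))
    (g := fun c => 2 * (Q ^ hookLength μ c - 1)) (fun c _ => Nat.zero_le _)
    (fun c hc => pow_rowLen_sub_le hQ hc)
  rw [Finset.prod_pow_eq_pow_sum, sum_rowLen_sub_eq, sum_snd_add_one, Finset.prod_mul_distrib,
    Finset.prod_const] at h
  rwa [add_comm]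

/-! ### Assembly over the Frobenius orbits -/

/-- `ψ_n(q) = ∏_{i=1}^n (q^i - 1) ≤ q^{n(n+1)/2} = q^{n(n-1)/2} q^n`. [folklore] -/
theorem psi_le (n q : ℕ) :
    (∏ i ∈ Finset.range n, (q ^ (i + 1) - 1)) ≤ q ^ (n * (n - 1) / 2) * q ^ n := by
  induction n with
  | zero => simp
  | succ n ih =>
    rw [Finset.prod_range_succ]
    have key : (n + 1) * (n + 1 - 1) / 2 = n * (n - 1) / 2 + n := by
      have h : (n + 1) * (n + 1 - 1) = n * (n - 1) + n * 2 := by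
        cases n with
        | zero => rfl
        | succ k => simp only [Nat.add_sub_cancel]; ring
      rw [h, Nat.add_mul_div_right _ _ two_pos]
    calc (∏ i ∈ Finset.range n, (q ^ (i + 1) - 1)) * (q ^ (n + 1) - 1)
        ≤ (q ^ (n * (n - 1) / 2) * q ^ n) * q ^ (n + 1) := Nat.mul_le_mul ih (Nat.sub_le _ _)
      _ = q ^ ((n + 1) * (n + 1 - 1) / 2) * q ^ (n + 1) := by rw [key]; ring

/-- **The elementary half of Green's degree bound** (Macdonald IV §6, from (6.7)): if a natural number `deg`
satisfies Green's degree identity in division-free form,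
`deg · ∏_i H̃_{μ_i}(q^{d_i}) = ψ_n(q) · ∏_i (q^{d_i})^{n(μ_i')}`, for a finite family of Frobenius degrees
`d_i ≥ 1` and diagrams `μ_i` with `Σ_i d_i |μ_i| = n` (and `q ≥ 2`), then `deg ≤ 2^n q^{n(n-1)/2}`.
Proof: multiply the identity by `∏_i (q^{d_i})^{|μ_i|} = q^n`, apply the hook estimate
`pow_card_add_colWeight_le` factorwise, cancel `∏_i (q^{d_i})^{n(μ_i')} > 0`, and use `Σ|μ_i| ≤ n`,
`ψ_n(q) ≤ q^{n(n-1)/2} q^n`. [cite: Macdonald1995, Ch. IV §6 (6.7)-(6.8)] -/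
theorem degree_le_of_hook_identity {ι : Type*} [Fintype ι] {q n deg : ℕ} (hq : 2 ≤ q)
    (d : ι → ℕ) (μ : ι → YoungDiagram) (hd : ∀ i, 1 ≤ d i)
    (hn : ∑ i, d i * (μ i).cells.card = n)
    (h : deg * ∏ i, ∏ c ∈ (μ i).cells, ((q ^ d i) ^ hookLength (μ i) c - 1) =
      (∏ i ∈ Finset.range n, (q ^ (i + 1) - 1)) * ∏ i, (q ^ d i) ^ ∑ c ∈ (μ i).cells, c.2) :
    deg ≤ 2 ^ n * q ^ (n * (n - 1) / 2) := by
  set H : ι → ℕ := fun i => ∏ c ∈ (μ i).cells, ((q ^ d i) ^ hookLength (μ i) c - 1) with hH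
  set N : ι → ℕ := fun i => (q ^ d i) ^ ∑ c ∈ (μ i).cells, c.2 with hN
  set C : ι → ℕ := fun i => (q ^ d i) ^ (μ i).cells.card with hC
  have hq0 : 0 < q := by omega
  have hQ : ∀ i, 2 ≤ q ^ d i := fun i =>
    le_trans (by simpa using hq) (Nat.pow_le_pow_right hq0 (hd i))
  have step : ∀ i, C i * N i ≤ 2 ^ (μ i).cells.card * H i := fun i => by
    simp only [hC, hN, hH, ← pow_add]
    exact pow_card_add_colWeight_le (hQ i) (μ i)
  have hprod : (∏ i, C i) * (∏ i, N i) ≤ 2 ^ (∑ i, (μ i).cells.card) * ∏ i, H i := by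
    rw [← Finset.prod_mul_distrib, ← Finset.prod_pow_eq_pow_sum, ← Finset.prod_mul_distrib]
    exact Finset.prod_le_prod (fun i _ => Nat.zero_le _) (fun i _ => step i)
  have hNpos : 0 < ∏ i, N i := Finset.prod_pos fun i _ => by positivity
  have key : deg * (∏ i, C i) * (∏ i, N i) ≤
      2 ^ (∑ i, (μ i).cells.card) * (∏ i ∈ Finset.range n, (q ^ (i + 1) - 1)) * ∏ i, N i :=
    calc deg * (∏ i, C i) * (∏ i, N i) = deg * ((∏ i, C i) * (∏ i, N i)) := by ring
      _ ≤ deg * (2 ^ (∑ i, (μ i).cells.card) * ∏ i, H i) := Nat.mul_le_mul_left _ hprod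
      _ = 2 ^ (∑ i, (μ i).cells.card) * (deg * ∏ i, H i) := by ring
      _ = 2 ^ (∑ i, (μ i).cells.card) * (∏ i ∈ Finset.range n, (q ^ (i + 1) - 1)) * ∏ i, N i := by
        rw [h]; ring
  have key2 : deg * (∏ i, C i) ≤
      2 ^ (∑ i, (μ i).cells.card) * (∏ i ∈ Finset.range n, (q ^ (i + 1) - 1)) :=
    Nat.le_of_mul_le_mul_right key hNpos
  have hCprod : ∏ i, C i = q ^ n := by
    simp only [hC, ← pow_mul]
    rw [Finset.prod_pow_eq_pow_sum, hn]
  have hcard : ∑ i, (μ i).cells.card ≤ n := by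
    rw [← hn]
    exact Finset.sum_le_sum fun i _ => by nlinarith [hd i]
  have h2 : 2 ^ (∑ i, (μ i).cells.card) ≤ 2 ^ n := Nat.pow_le_pow_right two_pos hcard
  have hqn : 0 < q ^ n := by positivity
  have hfin : deg * q ^ n ≤ 2 ^ n * q ^ (n * (n - 1) / 2) * q ^ n :=
    calc deg * q ^ n = deg * ∏ i, C i := by rw [hCprod]
      _ ≤ 2 ^ (∑ i, (μ i).cells.card) * (∏ i ∈ Finset.range n, (q ^ (i + 1) - 1)) := key2
      _ ≤ 2 ^ n * (q ^ (n * (n - 1) / 2) * q ^ n) := Nat.mul_le_mul h2 (psi_le n q)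
      _ = 2 ^ n * q ^ (n * (n - 1) / 2) * q ^ n := by ring
  exact Nat.le_of_mul_le_mul_right hfin hqn

/-! ### Real-exponent form, as in `GreenGLnDegreeBound` -/

/-- `(n(n-1) : ℕ)` cast to `ℝ` is `n · (n - 1)` (also for `n = 0`). [folklore] -/
theorem cast_mul_pred (n : ℕ) : ((n * (n - 1) : ℕ) : ℝ) = (n : ℝ) * (n - 1) := by
  cases n with
  | zero => simp
  | succ k =>
    simp only [Nat.add_sub_cancel]
    push_cast
    ring

/-- The right-hand side of `GreenGLnDegreeBound` is a natural number: `q^{n(n-1)/2}` with the real exponent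
`n(n-1)/2` equals the natural power `q^{⌊n(n-1)/2⌋}` (`n(n-1)` is even). [folklore] -/
theorem rpow_half_mul_pred_eq (q n : ℕ) :
    (q : ℝ) ^ ((n : ℝ) * (n - 1) / 2) = ((q ^ (n * (n - 1) / 2) : ℕ) : ℝ) := by
  obtain ⟨e, he⟩ := Nat.even_mul_pred_self n
  have h1 : n * (n - 1) / 2 = e := by omega
  have h2 : (n : ℝ) * (n - 1) / 2 = (e : ℝ) := by
    rw [← cast_mul_pred, he]
    push_cast
    ring
  rw [h2, h1, Real.rpow_natCast]
  push_cast
  rfl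

/-- **The elementary half, for a character.**  If `χ` is an irreducible complex character of a group `G`
whose degree satisfies Green's identity `χ(1) · ∏_i H̃_{μ_i}(q^{d_i}) = ψ_n(q) · ∏_i (q^{d_i})^{n(μ_i')}`
(cast into `ℂ`) for Frobenius degrees `d_i ≥ 1` and diagrams `μ_i` with `Σ d_i |μ_i| = n`, `q ≥ 2`, then
`χ(1) ≤ 2^n q^{n(n-1)/2}` in the form of `GreenGLnDegreeBound`.  With Green's degree formula
(Macdonald IV (6.7)–(6.8), not in the tree) for `G = GL_n(𝔽_q)` this is the bound.
[cite: Macdonald1995, Ch. IV §6 (6.7)-(6.8)] -/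
theorem re_apply_one_le_of_hook_identity {G : Type} [Group G] {χ : G → ℂ} (hχ : χ ∈ irrChars G)
    {ι : Type*} [Fintype ι] {q n : ℕ} (hq : 2 ≤ q) (d : ι → ℕ) (μ : ι → YoungDiagram)
    (hd : ∀ i, 1 ≤ d i) (hn : ∑ i, d i * (μ i).cells.card = n)
    (h : χ 1 * ((∏ i, ∏ c ∈ (μ i).cells, ((q ^ d i) ^ hookLength (μ i) c - 1) : ℕ) : ℂ) =
      (((∏ i ∈ Finset.range n, (q ^ (i + 1) - 1)) * ∏ i, (q ^ d i) ^ ∑ c ∈ (μ i).cells, c.2 : ℕ) : ℂ)) :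
    (χ 1).re ≤ 2 ^ n * (q : ℝ) ^ ((n : ℝ) * (n - 1) / 2) := by
  obtain ⟨deg, -, hdeg⟩ := IsIrrChar.exists_apply_one (show IsIrrChar G χ from hχ)
  rw [hdeg] at h ⊢
  have h' : deg * ∏ i, ∏ c ∈ (μ i).cells, ((q ^ d i) ^ hookLength (μ i) c - 1) =
      (∏ i ∈ Finset.range n, (q ^ (i + 1) - 1)) * ∏ i, (q ^ d i) ^ ∑ c ∈ (μ i).cells, c.2 := by
    exact_mod_cast h
  have hle := degree_le_of_hook_identity hq d μ hd hn h'
  rw [Complex.natCast_re, rpow_half_mul_pred_eq]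
  exact_mod_cast hle

/-! ### The cases `n ≤ 1` of the bound -/

/-- Square matrices indexed by a subsingleton type over a commutative semiring commute. [folklore] -/
theorem matrix_mul_comm_of_subsingleton {m R : Type*} [Fintype m] [Subsingleton m] [CommSemiring R]
    (A B : Matrix m m R) : A * B = B * A := by
  ext i j
  simp only [Matrix.mul_apply, Fintype.sum_subsingleton _ i]
  rw [Subsingleton.elim j i, mul_comm]

/-- `GL_m(R)` is commutative when `m` is a subsingleton (`GL_0`, `GL_1`). [folklore] -/
theorem isMulCommutative_generalLinearGroup_of_subsingleton (m R : Type*) [Fintype m] [DecidableEq m]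
    [Subsingleton m] [CommRing R] : IsMulCommutative (Matrix.GeneralLinearGroup m R) :=
  ⟨⟨fun a b => Units.ext (matrix_mul_comm_of_subsingleton (a : Matrix m m R) b)⟩⟩

/-- **`GreenGLnDegreeBound` for `n ≤ 1`**: `GL_0(𝔽_p)` and `GL_1(𝔽_p) = 𝔽_p^×` are abelian, so every
irreducible character has degree `1 ≤ 2^n = 2^n p^{n(n-1)/2}`. [folklore] -/
theorem greenGLnDegreeBound_of_le_one {n : ℕ} (hn : n ≤ 1) (p : ℕ) [Fact p.Prime]
    (χ : Matrix.GeneralLinearGroup (Fin n) (ZMod p) → ℂ)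
    (hχ : χ ∈ irrChars (Matrix.GeneralLinearGroup (Fin n) (ZMod p))) :
    (χ 1).re ≤ 2 ^ n * (p : ℝ) ^ ((n : ℝ) * (n - 1) / 2) := by
  haveI : Subsingleton (Fin n) := Fin.subsingleton_iff_le_one.2 hn
  haveI := isMulCommutative_generalLinearGroup_of_subsingleton (Fin n) (ZMod p)
  rw [IsIrrChar.map_one (show IsIrrChar _ χ from hχ), Complex.one_re]
  have hexp : (n : ℝ) * (n - 1) / 2 = 0 := by
    interval_cases n <;> norm_num
  rw [hexp, Real.rpow_zero, mul_one]
  exact one_le_pow₀ (by norm_num)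

end GreenGLn

end Literature.RepresentationTheory.FiniteGroups

end
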